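import Mathlib
import HarnessLib
import Literature.MathematicalPhysics.QuantumLattice.HubbardUVSymbolJoint
import Literature.MathematicalPhysics.QuantumLattice.ScaleZeroMultiplierSmooth
import Literature.MathematicalPhysics.QuantumLattice.HubbardScaleZeroSectorSymbolTime

/-!
# The infrared field cutoff `H₀(√(ν² + e²))` as ONE smooth function on the frequency–band plane: all mixed derivatives at once,
# `‖Dⁿ G(‖x‖²)‖ ≤ n!·B·(2/e₀)ⁿ` everywhere

Topic `MathematicalPhysics/QuantumLattice`; the MULTIPLIER twin of `HubbardUVSymbolJoint` (there: the ultraviolet covariance symbol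
`Ψ = χ₂(‖x‖²/Λ²)·c·(A x)⁻¹` on `FreqBand = EuclideanSpace ℝ (Fin 2)`, `x 0 = ω`, `x 1 = e`, and `‖DⁿΨ‖` for all `n`).  Here the first
factor of the scale-`0` sector multipliers of Benfatto–Giuliani–Mastropietro 2006 ((2.9), (2.45)–(2.48): `F_ω(k) = C₀⁻¹(√(k₀² + e(k⃗)²))·ζ_{0,ω}`,
`bgmMultiplier e₀ β e 0 ω` of `SectorisedKernelNorm`), i.e. the support function of the fields of scales `≤ 0`, read on the plane:
`M(x) = G(‖x‖²) = H₀(‖x‖)` with `G = bgmCutoffSq e₀` (`BGM2006Sec2ShellLineBounds`; `ScaleZeroMultiplierSmooth` has its first two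
derivatives by hand).  Since `G ≡ 1` below `e₀²/16` and `G ≡ 0` above `e₀²`, `M = g ∘ Q` with the UNIT profile `g(u) = G(e₀² u)`
(transition on `[1/16, 1]`, all derivatives bounded) and `Q x = ‖x‖²/e₀²` (`normSqDiv e₀`, `‖DⁱQ‖ ≤ (2/e₀)ⁱ` on the ball `‖x‖ ≤ e₀`),
so Mathlib's `norm_iteratedFDeriv_comp_le` gives every mixed partial `∂_ν^a ∂_e^b M` at once — the input of the space–time MOMENTS of the
scale-`0` multiplier kernels (cell gate-hubbard-kl, K3 engine, stub `stub_engine_scale0`, clause (E4)₀: the multiplier weighted torus sum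
`T_w`, product-weight Plancherel with mixed lattice differences, (2.36aa)):

* `bgmCutoffSqUnit e₀ u = G(e₀² u)`: smooth, `= 1` on `u ≤ 1/16`, `= 0` on `1 ≤ u`, `|·| ≤ 1`,
  **`exists_norm_iteratedDeriv_bgmCutoffSqUnit_le`** (`∃ B ≥ 1, ∀ i ≤ N, ‖g^{(i)}‖ ≤ B`);
* `bgmCutoff₂ e₀ = g ∘ Q`, `bgmCutoff₂_apply` (`= G(x₀² + x₁²)`), `bgmCutoff₂_eq_cutoffFreqFn` (`= cutoffFreqFn e₀ (x 1) (x 0)`, the factor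
  of `bgmGridSymbol`), `contDiff_bgmCutoff₂`, `abs_bgmCutoff₂_le_one`;
* `norm_iteratedFDeriv_bgmCutoff₂_le_ball` (`‖x‖ ≤ e₀`), `bgmCutoff₂_eventuallyEq_zero` / `iteratedFDeriv_bgmCutoff₂_eq_zero_of_gt`
  (`e₀ < ‖x‖`: locally `0`), `iteratedFDeriv_bgmCutoff₂_eq_zero_of_lt` (`‖x‖ < e₀/4`, `1 ≤ n`: locally `1`);
* **`norm_iteratedFDeriv_bgmCutoff₂_le`** — for `n ≤ N`, `B ≥ 1` as above and EVERY `x`: `‖iteratedFDeriv ℝ n (bgmCutoff₂ e₀) x‖ ≤ n!·B·(2/e₀)ⁿ`;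
  `norm_iteratedFDeriv_ofReal_bgmCutoff₂` (the complexified symbol has the same derivative norms).

Everything is proved; `bgmCutoffSqUnit`, `bgmCutoff₂` are the only definitions; no named facts.

## Sources

G. Benfatto, A. Giuliani, V. Mastropietro, Ann. Henri Poincaré 7 (2006) 809–898, §2.2 (2.9), §2.5 (2.45)–(2.48), Lemma 2.2 with (2.36aa)
(`BenfattoGiulianiMastropietro2006`); M. Salmhofer, *Renormalization* (1999), §4.2.4–4.2.5 (4.63), (4.70) (`Salmhofer1999`).
-/

noncomputable section

namespace Literature.MathematicalPhysics.QuantumLattice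

open Literature.MathematicalPhysics.QuantumLattice.FermiRG Set Filter
open scoped Nat Topology

/-! ### §1 The unit profile `g(u) = G(e₀² u)` -/

/-- The unit transition profile of the infrared cutoff: `g(u) = G(e₀²·u) = H₀(e₀√u)` (`G = bgmCutoffSq e₀`); its transition interval is
`[1/16, 1]`. [cite: BenfattoGiulianiMastropietro2006, §2.2 (2.9)] -/
def bgmCutoffSqUnit (e₀ u : ℝ) : ℝ := bgmCutoffSq e₀ (e₀ ^ 2 * u)

section Unit

variable {e₀ : ℝ}

/-- `g` is smooth. [cite: BenfattoGiulianiMastropietro2006, §2.2 (2.9)] -/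
theorem contDiff_bgmCutoffSqUnit (he : 0 < e₀) {m : ℕ∞} : ContDiff ℝ m (bgmCutoffSqUnit e₀) :=
  (contDiff_bgmCutoffSq he).comp (contDiff_const.mul contDiff_id)

/-- `g(u) = 1` for `u ≤ 1/16`. [cite: BenfattoGiulianiMastropietro2006, §2.2 (2.9)] -/
theorem bgmCutoffSqUnit_eq_one_of_le (he : 0 < e₀) {u : ℝ} (hu : u ≤ 1 / 16) : bgmCutoffSqUnit e₀ u = 1 :=
  bgmCutoffSq_eq_one_of_le he (by rw [show e₀ ^ 2 / 16 = e₀ ^ 2 * (1 / 16) by ring]; exact mul_le_mul_of_nonneg_left hu (sq_nonneg _))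

/-- `g(u) = 0` for `1 ≤ u`. [cite: BenfattoGiulianiMastropietro2006, §2.2 (2.9)] -/
theorem bgmCutoffSqUnit_eq_zero_of_le (he : 0 < e₀) {u : ℝ} (hu : 1 ≤ u) : bgmCutoffSqUnit e₀ u = 0 :=
  bgmCutoffSq_eq_zero_of_le he (by simpa using mul_le_mul_of_nonneg_left hu (sq_nonneg e₀))

/-- `|g| ≤ 1`. [cite: BenfattoGiulianiMastropietro2006, §2.2 (2.9)] -/
theorem abs_bgmCutoffSqUnit_le_one (e₀ u : ℝ) : |bgmCutoffSqUnit e₀ u| ≤ 1 := abs_bgmCutoffSq_le_one e₀ _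

/-- The derivatives of positive order of `g` vanish off the transition interval `[1/16, 1]`, and all derivatives vanish above `1`.
[cite: BenfattoGiulianiMastropietro2006, §2.2 (2.9)] -/
theorem iteratedDeriv_bgmCutoffSqUnit_eq_zero (he : 0 < e₀) {m : ℕ} {u : ℝ} (hu : (u < 1 / 16 ∧ 1 ≤ m) ∨ 1 < u) :
    iteratedDeriv m (bgmCutoffSqUnit e₀) u = 0 := by
  rcases hu with ⟨hu, hm⟩ | hu
  · have hev : bgmCutoffSqUnit e₀ =ᶠ[𝓝 u] fun _ => (1 : ℝ) := by
      filter_upwards [Iio_mem_nhds hu] with v hv using bgmCutoffSqUnit_eq_one_of_le he (le_of_lt hv)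
    rw [hev.iteratedDeriv_eq, iteratedDeriv_const]
    simp [show m ≠ 0 by omega]
  · have hev : bgmCutoffSqUnit e₀ =ᶠ[𝓝 u] fun _ => (0 : ℝ) := by
      filter_upwards [Ioi_mem_nhds hu] with v hv using bgmCutoffSqUnit_eq_zero_of_le he (le_of_lt hv)
    rw [hev.iteratedDeriv_eq, iteratedDeriv_const]
    simp

/-- **All derivatives of the unit profile are bounded**: for every `N` there is `B ≥ 1` with `‖g^{(i)}(u)‖ ≤ B` for all `i ≤ N` and all `u`
(`g^{(i)}` is continuous and vanishes off the compact interval `[1/16, 1]` for `i ≥ 1`; `|g| ≤ 1`).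
[cite: BenfattoGiulianiMastropietro2006, §2.2 (2.9)] -/
theorem exists_norm_iteratedDeriv_bgmCutoffSqUnit_le (he : 0 < e₀) (N : ℕ) :
    ∃ B : ℝ, 1 ≤ B ∧ ∀ i ≤ N, ∀ u : ℝ, ‖iteratedDeriv i (bgmCutoffSqUnit e₀) u‖ ≤ B := by
  -- each positive order is bounded
  have hbd : ∀ m : ℕ, 1 ≤ m → ∃ C : ℝ, 0 ≤ C ∧ ∀ u, ‖iteratedDeriv m (bgmCutoffSqUnit e₀) u‖ ≤ C := by
    intro m hm
    have hcont : Continuous (iteratedDeriv m (bgmCutoffSqUnit e₀)) :=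
      (contDiff_bgmCutoffSqUnit he (m := m)).continuous_iteratedDeriv' m
    obtain ⟨C, hC⟩ := (isCompact_Icc (a := (1 : ℝ) / 16) (b := 1)).exists_bound_of_continuousOn hcont.continuousOn
    refine ⟨max C 0, le_max_right _ _, fun u => ?_⟩
    by_cases hu : u ∈ Icc ((1 : ℝ) / 16) 1
    · exact (hC u hu).trans (le_max_left _ _)
    · rw [mem_Icc, not_and_or, not_le, not_le] at hu
      have h0 : iteratedDeriv m (bgmCutoffSqUnit e₀) u = 0 :=
        iteratedDeriv_bgmCutoffSqUnit_eq_zero he (hu.elim (fun h => Or.inl ⟨h, hm⟩) Or.inr)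
      rw [h0, norm_zero]
      exact le_max_right _ _
  -- take the maximum over `1 ≤ m ≤ N` together with `1`
  induction N with
  | zero =>
    refine ⟨1, le_rfl, fun i hi u => ?_⟩
    rw [Nat.le_zero.1 hi, iteratedDeriv_zero, Real.norm_eq_abs]
    exact abs_bgmCutoffSqUnit_le_one e₀ u
  | succ N ih =>
    obtain ⟨B, hB1, hB⟩ := ih
    obtain ⟨C, hC0, hC⟩ := hbd (N + 1) (Nat.succ_pos N)
    refine ⟨max B C, le_max_of_le_left hB1, fun i hi u => ?_⟩
    rcases Nat.lt_or_ge i (N + 1) with h | h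
    · exact (hB i (Nat.lt_succ_iff.1 h) u).trans (le_max_left _ _)
    · rw [le_antisymm hi h]
      exact (hC u).trans (le_max_right _ _)

end Unit

/-! ### §2 The cutoff on the plane `M = g ∘ Q` -/

/-- **The infrared field cutoff on the frequency–band plane**: `M(x) = g(‖x‖²/e₀²) = G(‖x‖²) = H₀(‖x‖)` (`x 0 = ν`, `x 1 = e`).
[cite: BenfattoGiulianiMastropietro2006, §2.5 (2.48)] -/
def bgmCutoff₂ (e₀ : ℝ) (x : FreqBand) : ℝ := bgmCutoffSqUnit e₀ (normSqDiv e₀ x)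

section Plane

variable {e₀ : ℝ}

/-- `M(x) = G(x₀² + x₁²)` (`e₀ ≠ 0`). [cite: BenfattoGiulianiMastropietro2006, §2.5 (2.48)] -/
theorem bgmCutoff₂_apply (he : e₀ ≠ 0) (x : FreqBand) : bgmCutoff₂ e₀ x = bgmCutoffSq e₀ (x 0 ^ 2 + x 1 ^ 2) := by
  rw [bgmCutoff₂, bgmCutoffSqUnit, normSqDiv, norm_sq_freqBand]
  congr 1
  field_simp

/-- **`M` is the cutoff factor of the padded scale-`0` multiplier**: `M(x) = cutoffFreqFn e₀ (x 1) (x 0)` (`= H₀(√(ν² + e²))` at `ν = x 0`,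
`e = x 1`; `e₀ ≠ 0`). [cite: BenfattoGiulianiMastropietro2006, §2.5 (2.48)] -/
theorem bgmCutoff₂_eq_cutoffFreqFn (he : e₀ ≠ 0) (x : FreqBand) : bgmCutoff₂ e₀ x = cutoffFreqFn e₀ (x 1) (x 0) := by
  rw [bgmCutoff₂_apply he, cutoffFreqFn, gnSqCutoff, bgmCutoffSq]

/-- `M` is smooth. [cite: BenfattoGiulianiMastropietro2006, §2.2 (2.9)] -/
theorem contDiff_bgmCutoff₂ (he : 0 < e₀) {n : ℕ∞} : ContDiff ℝ n (bgmCutoff₂ e₀) :=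
  (contDiff_bgmCutoffSqUnit he (m := n)).comp (contDiff_normSqDiv e₀)

/-- `|M| ≤ 1`. [cite: BenfattoGiulianiMastropietro2006, §2.2 (2.9)] -/
theorem abs_bgmCutoff₂_le_one (e₀ : ℝ) (x : FreqBand) : |bgmCutoff₂ e₀ x| ≤ 1 := abs_bgmCutoffSqUnit_le_one e₀ _

/-- **`M`'s derivatives on the ball `‖x‖ ≤ e₀`**: if `‖g^{(i)}‖ ≤ B` for `i ≤ n` then `‖DⁿM(x)‖ ≤ n!·B·(2/e₀)ⁿ`.
[cite: BenfattoGiulianiMastropietro2006, Lemma 2.2 (2.36aa)] -/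
theorem norm_iteratedFDeriv_bgmCutoff₂_le_ball (he : 0 < e₀) {n : ℕ} {B : ℝ}
    (hB : ∀ i ≤ n, ∀ u, ‖iteratedDeriv i (bgmCutoffSqUnit e₀) u‖ ≤ B) {x : FreqBand} (hx : ‖x‖ ≤ e₀) :
    ‖iteratedFDeriv ℝ n (bgmCutoff₂ e₀) x‖ ≤ n ! * B * (2 / e₀) ^ n := by
  have h : bgmCutoff₂ e₀ = bgmCutoffSqUnit e₀ ∘ normSqDiv e₀ := rfl
  rw [h]
  refine norm_iteratedFDeriv_comp_le (N := (n : ℕ∞)) (contDiff_bgmCutoffSqUnit he (m := n)) (contDiff_normSqDiv e₀) le_rfl x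
    (fun i hi => ?_) (fun i hi1 hin => ?_)
  · rw [norm_iteratedFDeriv_eq_norm_iteratedDeriv]
    exact hB i hi _
  · exact norm_iteratedFDeriv_normSqDiv_le he hx hi1

/-- Outside the closed ball (`e₀ < ‖x‖`) the cutoff vanishes identically near `x`. [cite: BenfattoGiulianiMastropietro2006, §2.2 (2.9)] -/
theorem bgmCutoff₂_eventuallyEq_zero (he : 0 < e₀) {x : FreqBand} (hx : e₀ < ‖x‖) : bgmCutoff₂ e₀ =ᶠ[𝓝 x] fun _ => (0 : ℝ) := by
  have hopen : IsOpen {y : FreqBand | e₀ < ‖y‖} := isOpen_lt continuous_const continuous_norm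
  filter_upwards [hopen.mem_nhds hx] with y hy
  have hy' : e₀ < ‖y‖ := hy
  refine bgmCutoffSqUnit_eq_zero_of_le he ?_
  rw [normSqDiv, le_div_iff₀ (by positivity), one_mul]
  nlinarith [norm_nonneg y, he]

/-- `M(x) = 0` for `e₀ ≤ ‖x‖`. [cite: BenfattoGiulianiMastropietro2006, §2.2 (2.9)] -/
theorem bgmCutoff₂_eq_zero_of_le (he : 0 < e₀) {x : FreqBand} (hx : e₀ ≤ ‖x‖) : bgmCutoff₂ e₀ x = 0 := by
  refine bgmCutoffSqUnit_eq_zero_of_le he ?_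
  rw [normSqDiv, le_div_iff₀ (by positivity), one_mul]
  nlinarith [norm_nonneg x, he]

/-- Outside the closed ball all derivatives (and the value) vanish. [cite: BenfattoGiulianiMastropietro2006, §2.2 (2.9)] -/
theorem iteratedFDeriv_bgmCutoff₂_eq_zero_of_gt (he : 0 < e₀) {x : FreqBand} (hx : e₀ < ‖x‖) (n : ℕ) :
    iteratedFDeriv ℝ n (bgmCutoff₂ e₀) x = 0 := by
  rw [((bgmCutoff₂_eventuallyEq_zero he hx).iteratedFDeriv ℝ n).eq_of_nhds, iteratedFDeriv_fun_zero]
  rfl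

/-- Inside the ball `‖x‖ < e₀/4` the cutoff is identically `1` near `x`, so its derivatives of positive order vanish.
[cite: BenfattoGiulianiMastropietro2006, §2.2 (2.9)] -/
theorem iteratedFDeriv_bgmCutoff₂_eq_zero_of_lt (he : 0 < e₀) {x : FreqBand} (hx : ‖x‖ < e₀ / 4) {n : ℕ} (hn : 1 ≤ n) :
    iteratedFDeriv ℝ n (bgmCutoff₂ e₀) x = 0 := by
  have hev : bgmCutoff₂ e₀ =ᶠ[𝓝 x] fun _ => (1 : ℝ) := by
    have hopen : IsOpen {y : FreqBand | ‖y‖ < e₀ / 4} := isOpen_lt continuous_norm continuous_const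
    filter_upwards [hopen.mem_nhds hx] with y hy
    have hy' : ‖y‖ < e₀ / 4 := hy
    refine bgmCutoffSqUnit_eq_one_of_le he ?_
    rw [normSqDiv, div_le_iff₀ (by positivity)]
    nlinarith [norm_nonneg y, he]
  rw [(hev.iteratedFDeriv ℝ n).eq_of_nhds, iteratedFDeriv_const_of_ne (by omega)]
  rfl

/-- `M(x) = 1` for `‖x‖ ≤ e₀/4`. [cite: BenfattoGiulianiMastropietro2006, §2.2 (2.9)] -/
theorem bgmCutoff₂_eq_one_of_le (he : 0 < e₀) {x : FreqBand} (hx : ‖x‖ ≤ e₀ / 4) : bgmCutoff₂ e₀ x = 1 := by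
  refine bgmCutoffSqUnit_eq_one_of_le he ?_
  rw [normSqDiv, div_le_iff₀ (by positivity)]
  nlinarith [norm_nonneg x, he]

/-- **All derivatives of the infrared cutoff at once**: if `B ≥ 1` bounds `‖g^{(i)}‖` for `i ≤ N`, then for `n ≤ N` and EVERY `x`,
`‖iteratedFDeriv ℝ n (bgmCutoff₂ e₀) x‖ ≤ n!·B·(2/e₀)ⁿ` — every mixed partial `∂_ν^a ∂_e^b M`, `a + b = n`, is bounded by the right side.
[cite: BenfattoGiulianiMastropietro2006, Lemma 2.2 (2.36aa)] -/
theorem norm_iteratedFDeriv_bgmCutoff₂_le (he : 0 < e₀) {N : ℕ} {B : ℝ} (hB1 : 1 ≤ B)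
    (hB : ∀ i ≤ N, ∀ u, ‖iteratedDeriv i (bgmCutoffSqUnit e₀) u‖ ≤ B) {n : ℕ} (hn : n ≤ N) (x : FreqBand) :
    ‖iteratedFDeriv ℝ n (bgmCutoff₂ e₀) x‖ ≤ n ! * B * (2 / e₀) ^ n := by
  by_cases hx : ‖x‖ ≤ e₀
  · exact norm_iteratedFDeriv_bgmCutoff₂_le_ball he (fun i hi u => hB i (hi.trans hn) u) hx
  · rw [iteratedFDeriv_bgmCutoff₂_eq_zero_of_gt he (lt_of_not_ge hx) n, norm_zero]
    have : 0 ≤ B := zero_le_one.trans hB1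
    positivity

/-- **The convenient packaged form**: for every `N` there is `B ≥ 1` with `‖iteratedFDeriv ℝ n (bgmCutoff₂ e₀) x‖ ≤ n!·B·(2/e₀)ⁿ` for all
`n ≤ N` and all `x`. [cite: BenfattoGiulianiMastropietro2006, Lemma 2.2 (2.36aa)] -/
theorem exists_norm_iteratedFDeriv_bgmCutoff₂_le (he : 0 < e₀) (N : ℕ) :
    ∃ B : ℝ, 1 ≤ B ∧ ∀ n ≤ N, ∀ x : FreqBand, ‖iteratedFDeriv ℝ n (bgmCutoff₂ e₀) x‖ ≤ n ! * B * (2 / e₀) ^ n := by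
  obtain ⟨B, hB1, hB⟩ := exists_norm_iteratedDeriv_bgmCutoffSqUnit_le he N
  exact ⟨B, hB1, fun n hn x => norm_iteratedFDeriv_bgmCutoff₂_le he hB1 hB hn x⟩

/-- The derivatives of the complexified cutoff have the norms of those of the cutoff. [cite: BenfattoGiulianiMastropietro2006, Lemma 2.2 (2.36aa)] -/
theorem norm_iteratedFDeriv_ofReal_bgmCutoff₂ (he : 0 < e₀) (i : ℕ) (x : FreqBand) :
    ‖iteratedFDeriv ℝ i (fun y => ((bgmCutoff₂ e₀ y : ℝ) : ℂ)) x‖ = ‖iteratedFDeriv ℝ i (bgmCutoff₂ e₀) x‖ := by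
  have h : (fun y => ((bgmCutoff₂ e₀ y : ℝ) : ℂ)) = Complex.ofRealLI ∘ bgmCutoff₂ e₀ := rfl
  rw [h, Complex.ofRealLI.norm_iteratedFDeriv_comp_left ((contDiff_bgmCutoff₂ he (n := i)).contDiffAt) le_rfl]

end Plane

end Literature.MathematicalPhysics.QuantumLattice

end
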